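import Literature.NumberTheory.LFunctions.KloostermanFractionsOffDiagSet
import HarnessLib

/-!
# Trilinear forms with Kloosterman fractions: partial summation against a phase of bounded variation

Topic `NumberTheory/LFunctions`.  S. Bettin, V. Chandee, *Trilinear forms with Kloosterman
fractions*, Adv. Math. 328 (2018), Remark 2 ("we can remove the weight by partial summation")
and §4.1.3 (the twist "`ϑa₂(dℓ̃₁'−d'ℓ̃₁)/(bℓ̃₁ℓ̃₁'𝔭₁n₁'𝔮₁𝔮₂n₂') ≪ |ϑ|AD/(bLN²)`" removed "by using
partial summation").  For the trilinear, twisted off-diagonal the `n₂`-sums carry a smooth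
unimodular factor `e(ρ(n₂))` whose phase `ρ` is a sum of finitely many MONOTONE pieces
(`C₀/n₂`, `C₁/(ℓ₁n₁ − ℓ₂n₂)`, `C₂/(ℓ₁'n₁ − ℓ₂'n₂)`).  This file PROVES the corresponding generic
Abel-summation bound (from the tree's `kfw_abel_bound`):

* `BC_norm_e_sub_e_le` — `‖e(u) − e(v)‖ ≤ 2π|u − v|`;
* `BC_monotone_step_eq` — for `ρ` monotone or antitone on `[y, x₂]` and `y ≤ n < x₂`:
  `|ρ(n+1) − ρ(n)| = |ρ(n) − ρ(x₂)| − |ρ(n+1) − ρ(x₂)|`;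
* **`BC_abel_exp_monotone_le`** — if all partial sums `∑_{x₁<n≤y, p n} g(n)` (`y ≤ x₂`) have norm
  `≤ B` and each `ρᵢ` is monotone or antitone on `[x₁+1, x₂]`, then
  `‖∑_{x₁<n≤x₂, p n} g(n) e(∑ᵢ ρᵢ(n))‖ ≤ B (1 + 2π ∑ᵢ |ρᵢ(x₁+1) − ρᵢ(x₂)|)`.

No new named facts (D-0026).

## References

* S. Bettin, V. Chandee, Adv. Math. 328 (2018) 1234–1262 (arXiv:1502.00769), Remark 2, §4.1.3
  (the display after (afed)). [BettinChandee2018]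
-/

noncomputable section

open Finset

namespace Literature.NumberTheory.LFunctions

/-- `‖e(u) − e(v)‖ ≤ 2π|u − v|` for real `u, v`. [folklore] -/
theorem BC_norm_e_sub_e_le (u v : ℝ) :
    ‖Complex.exp (2 * Real.pi * Complex.I * (u : ℂ)) -
        Complex.exp (2 * Real.pi * Complex.I * (v : ℂ))‖ ≤ 2 * Real.pi * |u - v| := by
  have hfac : Complex.exp (2 * Real.pi * Complex.I * (u : ℂ)) -
      Complex.exp (2 * Real.pi * Complex.I * (v : ℂ)) =
      Complex.exp (2 * Real.pi * Complex.I * (v : ℂ)) *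
        (Complex.exp (Complex.I * ((2 * Real.pi * (u - v) : ℝ) : ℂ)) - 1) := by
    rw [mul_sub, mul_one, ← Complex.exp_add]
    congr 2
    push_cast; ring
  rw [hfac, norm_mul]
  have h1 : ‖Complex.exp (2 * Real.pi * Complex.I * (v : ℂ))‖ = 1 := by
    have : 2 * (Real.pi : ℂ) * Complex.I * (v : ℂ) = ((2 * Real.pi * v : ℝ) : ℂ) * Complex.I := by
      push_cast; ring
    rw [this, Complex.norm_exp_ofReal_mul_I]
  rw [h1, one_mul]
  refine (Real.norm_exp_I_mul_ofReal_sub_one_le).trans (le_of_eq ?_)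
  rw [Real.norm_eq_abs, abs_mul, abs_of_pos Real.two_pi_pos]

/-- For `ρ` monotone or antitone on `[y, x₂]` and `y ≤ n`, `n + 1 ≤ x₂`:
`|ρ(n+1) − ρ(n)| = |ρ(n) − ρ(x₂)| − |ρ(n+1) − ρ(x₂)|`. [folklore] -/
theorem BC_monotone_step_eq (ρ : ℤ → ℝ) {y x₂ n : ℤ}
    (hmono : MonotoneOn ρ (Set.Icc y x₂) ∨ AntitoneOn ρ (Set.Icc y x₂)) (hyn : y ≤ n)
    (hn : n + 1 ≤ x₂) :
    |ρ (n + 1) - ρ n| = |ρ n - ρ x₂| - |ρ (n + 1) - ρ x₂| := by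
  have hnmem : n ∈ Set.Icc y x₂ := ⟨hyn, by omega⟩
  have hn1mem : n + 1 ∈ Set.Icc y x₂ := ⟨by omega, hn⟩
  have hx₂mem : x₂ ∈ Set.Icc y x₂ := ⟨by omega, le_rfl⟩
  rcases hmono with h | h
  · have h1 : ρ n ≤ ρ (n + 1) := h hnmem hn1mem (by omega)
    have h2 : ρ (n + 1) ≤ ρ x₂ := h hn1mem hx₂mem hn
    rw [abs_of_nonneg (by linarith), abs_of_nonpos (by linarith), abs_of_nonpos (by linarith)]
    ring
  · have h1 : ρ (n + 1) ≤ ρ n := h hnmem hn1mem (by omega)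
    have h2 : ρ x₂ ≤ ρ (n + 1) := h hn1mem hx₂mem hn
    rw [abs_of_nonpos (by linarith), abs_of_nonneg (by linarith), abs_of_nonneg (by linarith)]
    ring

/-- **Partial summation against `e(∑ᵢ ρᵢ(n))` with monotone pieces**: if all partial sums
`∑_{x₁<n≤y, p n} g(n)` (`x₁ ≤ y ≤ x₂`) have norm `≤ B` and each `ρᵢ` is monotone or antitone on
`[x₁+1, x₂]`, then
`‖∑_{x₁<n≤x₂, p n} g(n) e(∑ᵢ ρᵢ(n))‖ ≤ B (1 + 2π ∑ᵢ |ρᵢ(x₁+1) − ρᵢ(x₂)|)`.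
[cite: BettinChandee2018, Remark 2 and §4.1.3] -/
theorem BC_abel_exp_monotone_le {ι : Type*} (s : Finset ι) (ρ : ι → ℤ → ℝ) {x₁ x₂ : ℤ}
    (hx : x₁ < x₂) (p : ℤ → Prop) [DecidablePred p] (g : ℤ → ℂ) {B : ℝ} (hB : 0 ≤ B)
    (hpartial : ∀ y : ℤ, x₁ ≤ y → y ≤ x₂ → ‖∑ n ∈ (Ioc x₁ y).filter p, g n‖ ≤ B)
    (hmono : ∀ i ∈ s, MonotoneOn (ρ i) (Set.Icc (x₁ + 1) x₂) ∨ AntitoneOn (ρ i) (Set.Icc (x₁ + 1) x₂)) :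
    ‖∑ n ∈ (Ioc x₁ x₂).filter p,
        g n * Complex.exp (2 * Real.pi * Complex.I * ((∑ i ∈ s, ρ i n : ℝ) : ℂ))‖ ≤
      B * (1 + 2 * Real.pi * ∑ i ∈ s, |ρ i (x₁ + 1) - ρ i x₂|) := by
  obtain ⟨K, hK⟩ : ∃ K : ℕ, x₂ = x₁ + K := ⟨(x₂ - x₁).toNat, by omega⟩
  have hK1 : 1 ≤ K := by omega
  -- the phase, frozen beyond `x₂`
  set f : ℤ → ℂ := fun n => Complex.exp (2 * Real.pi * Complex.I *
    ((∑ i ∈ s, ρ i (min n x₂) : ℝ) : ℂ)) with hf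
  set φ : ℤ → ℝ := fun n => 2 * Real.pi * ∑ i ∈ s, |ρ i (min n x₂) - ρ i x₂| with hφ
  have hf1 : ∀ n : ℤ, ‖f n‖ ≤ 1 := by
    intro n
    simp only [hf]
    have : 2 * (Real.pi : ℂ) * Complex.I * ((∑ i ∈ s, ρ i (min n x₂) : ℝ) : ℂ) =
        ((2 * Real.pi * ∑ i ∈ s, ρ i (min n x₂) : ℝ) : ℂ) * Complex.I := by push_cast; ring
    rw [this, Complex.norm_exp_ofReal_mul_I]
  have hvar : ∀ n : ℤ, x₁ < n → ‖f (n + 1) - f n‖ ≤ φ n - φ (n + 1) := by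
    intro n hn
    simp only [hf, hφ]
    by_cases hn2 : n + 1 ≤ x₂
    · have hmin1 : min n x₂ = n := min_eq_left (by omega)
      have hmin2 : min (n + 1) x₂ = n + 1 := min_eq_left hn2
      rw [hmin1, hmin2]
      refine (BC_norm_e_sub_e_le _ _).trans ?_
      rw [← mul_sub, ← Finset.sum_sub_distrib, ← Finset.sum_sub_distrib]
      apply mul_le_mul_of_nonneg_left _ Real.two_pi_pos.le
      refine (Finset.abs_sum_le_sum_abs _ _).trans (Finset.sum_le_sum fun i hi => ?_)
      rw [BC_monotone_step_eq (ρ i) (hmono i hi) (by omega) hn2]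
    · have hmin1 : min n x₂ = x₂ := min_eq_right (by omega)
      have hmin2 : min (n + 1) x₂ = x₂ := min_eq_right (by omega)
      rw [hmin1, hmin2, sub_self, norm_zero]
      simp
  have hpartial' : ∀ k : ℕ, k ≤ K → ‖∑ n ∈ (Ioc x₁ (x₁ + k)).filter p, g n‖ ≤ B :=
    fun k hk => hpartial (x₁ + k) (by omega) (by omega)
  have habel := kfw_abel_bound x₁ hK1 p g f φ hB hpartial' hf1 hvar
  -- on `(x₁, x₂]` the frozen phase is the phase
  have hsum : ∑ n ∈ (Ioc x₁ x₂).filter p,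
      g n * Complex.exp (2 * Real.pi * Complex.I * ((∑ i ∈ s, ρ i n : ℝ) : ℂ)) =
      ∑ n ∈ (Ioc x₁ (x₁ + K)).filter p, g n * f n := by
    rw [← hK]
    refine Finset.sum_congr rfl fun n hn => ?_
    have hn' := (Finset.mem_Ioc.mp (Finset.mem_filter.mp hn).1).2
    simp only [hf, min_eq_left hn']
  rw [hsum]
  refine habel.trans ?_
  have hφK : φ (x₁ + K) = 0 := by
    simp only [hφ, ← hK, min_self, sub_self, abs_zero, Finset.sum_const_zero, mul_zero]
  have hφ1 : φ (x₁ + 1) = 2 * Real.pi * ∑ i ∈ s, |ρ i (x₁ + 1) - ρ i x₂| := by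
    simp only [hφ, min_eq_left (show x₁ + 1 ≤ x₂ by omega)]
  rw [hφK, hφ1, sub_zero]

/-- `x ↦ C/x` is monotone or antitone on any set of positive integers. [folklore] -/
theorem BC_monotoneOn_const_div (C : ℝ) {y x₂ : ℤ} (hy : 0 < y) :
    MonotoneOn (fun x : ℤ => C / (x : ℝ)) (Set.Icc y x₂) ∨
      AntitoneOn (fun x : ℤ => C / (x : ℝ)) (Set.Icc y x₂) := by
  rcases le_or_gt 0 C with hC | hC
  · right
    intro u hu v hv huv
    have hu0 : (0 : ℝ) < u := by exact_mod_cast lt_of_lt_of_le hy hu.1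
    have huv' : (u : ℝ) ≤ v := by exact_mod_cast huv
    exact div_le_div_of_nonneg_left hC hu0 huv'
  · left
    intro u hu v hv huv
    have hu0 : (0 : ℝ) < u := by exact_mod_cast lt_of_lt_of_le hy hu.1
    have huv' : (u : ℝ) ≤ v := by exact_mod_cast huv
    have h := div_le_div_of_nonneg_left (neg_nonneg.mpr hC.le) hu0 huv'
    simp only [neg_div] at h
    show C / (u : ℝ) ≤ C / (v : ℝ)
    linarith

/-- `x ↦ C/(α − βx)` (`β ≥ 0`) is monotone or antitone on an integer interval on which `α − βx`
keeps a constant sign (for the `n₂`-sums: `w(n₂) = ℓ₁n₁ − ℓ₂n₂` with `w/d ∈ (M₁, M₂]`).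
[folklore] -/
theorem BC_monotoneOn_const_div_affine (C α β : ℝ) (hβ : 0 ≤ β) {y x₂ : ℤ}
    (hsign : (∀ x : ℤ, x ∈ Set.Icc y x₂ → 0 < α - β * x) ∨
      (∀ x : ℤ, x ∈ Set.Icc y x₂ → α - β * x < 0)) :
    MonotoneOn (fun x : ℤ => C / (α - β * (x : ℝ))) (Set.Icc y x₂) ∨
      AntitoneOn (fun x : ℤ => C / (α - β * (x : ℝ))) (Set.Icc y x₂) := by
  -- `x ↦ 1/(α − βx)` is monotone (increasing) in both sign cases
  have hmono : ∀ u ∈ Set.Icc y x₂, ∀ v ∈ Set.Icc y x₂, u ≤ v →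
      1 / (α - β * (u : ℝ)) ≤ 1 / (α - β * (v : ℝ)) := by
    intro u hu v hv huv
    have huv' : (u : ℝ) ≤ v := by exact_mod_cast huv
    have hwle : α - β * (v : ℝ) ≤ α - β * (u : ℝ) := by nlinarith
    rcases hsign with h | h
    · exact one_div_le_one_div_of_le (h v hv) hwle
    · exact (one_div_le_one_div_of_neg (h u hu) (h v hv)).mpr hwle
  rcases le_or_gt 0 C with hC | hC
  · left
    intro u hu v hv huv
    have h1 := hmono u hu v hv huv
    show C / (α - β * (u : ℝ)) ≤ C / (α - β * (v : ℝ))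
    have e1 : C / (α - β * (u : ℝ)) = C * (1 / (α - β * (u : ℝ))) := by ring
    have e2 : C / (α - β * (v : ℝ)) = C * (1 / (α - β * (v : ℝ))) := by ring
    rw [e1, e2]
    exact mul_le_mul_of_nonneg_left h1 hC
  · right
    intro u hu v hv huv
    have h1 := hmono u hu v hv huv
    show C / (α - β * (v : ℝ)) ≤ C / (α - β * (u : ℝ))
    have e1 : C / (α - β * (u : ℝ)) = C * (1 / (α - β * (u : ℝ))) := by ring
    have e2 : C / (α - β * (v : ℝ)) = C * (1 / (α - β * (v : ℝ))) := by ring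
    rw [e1, e2]
    exact mul_le_mul_of_nonpos_left h1 hC.le


end Literature.NumberTheory.LFunctions

end
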